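import Literature.Probability.LatticeModels.FreeStateLimit
import Literature.Probability.LatticeModels.IsingFreeConsistency
import Literature.Probability.LatticeModels.GibbsStates
import Literature.Probability.LatticeModels.IsingTranslationInvariance
import HarnessLib

/-!
# The free infinite-volume Ising state is a translation-invariant Gibbs measure (discharge of `exists_freeMeasure`)

Topic `Literature/Probability/LatticeModels`. Second half of the discharge of the named fact
`exists_freeMeasure` (`GibbsStates.lean`, crit-ising.S05: for `β ≥ 0`, `h ≥ 0` the free state
`⟨·⟩^∅_{β,h}` of `ℤ^d` is a probability measure satisfying the DLR equations for the Ising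
specification, translation invariant, with correlations `freeCorr d β h`). The limit measure is the
one of `FreeStateLimit` (`exists_measure_integral_eq_freeExpect`: `⟨F⟩^∅_{Λ_L;β,h} → ∫ F dμ` for
every local `F`); here:

* `isGibbsMeasure_of_tendsto_isingExpect_free_box` — **limits of free boxes are Gibbs**
  (Friedli–Velenik 2017, Thm. 6.26 / Exercise 3.16): for a local event `A` the boundary-condition
  dependence `η ↦ μ^η_{Λ;β,h}(A)` is a local observable (`dependsOn_isingMeasure_fixed_real`:
  it only sees `η` on `∂ᵉˣΛ` and on the window of `A`), so
  `∫ μ^η_Λ(A) dμ(η) = lim_L ⟨μ^·_Λ(A)⟩^∅_{Λ_L} = lim_L μ^∅_{Λ_L}(A) = μ(A)` by the finite-volume DLR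
  identity of the free boxes (`lintegral_isingMeasure_fixed_free`, `IsingFreeConsistency`, valid
  once `Λ ∪ ∂ᵉˣΛ ⊆ Λ_L`); the two sides are probability measures in `A` (`Measure.bind`) agreeing
  on the preimages of the local events of `Set (Site d)`, hence equal
  (`measure_eq_of_forall_isLocalEvent_preimage_eq`, π-λ through `spinConfigEquivSet`).
* `isTranslationInvariantMeasure_of_spinCorr_eq_freeCorr` — a probability measure with the free
  correlations is translation invariant: `σ_B ∘ θ_v = σ_{B-v}` and
  `⟨σ_{B-v}⟩^∅ = ⟨σ_B⟩^∅` (`freeCorr_shift`, tree), while the spin correlations determine the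
  measure (`measure_eq_of_forall_spinCorr_eq`, via Friedli–Velenik 2017, Lemma 3.19).
* `exists_freeMeasure_holds` — the discharge.

No sign condition on `β, h` is needed for the DLR step; `β, h ≥ 0` enters only through the
existence of the limit (GKS) and `freeCorr_shift`.

## Mathlib

`Measure.bind` / `Measure.bind_apply`, `Measure.measurable_of_measurable_coe`,
`MeasureTheory.ofReal_integral_eq_lintegral_ofReal`, `MeasurableEquiv.map_symm_map`,
`integral_map`. No Gibbs measures in Mathlib.
-/

noncomputable section

open MeasureTheory Filter Topology Finset
open Literature.Probability.Percolation

namespace Literature.Probability.LatticeModels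

/-! ### Measures on spin configurations are determined by local events / spin correlations -/

section Determination

variable {V : Type*}

/-- **A finite measure on `{±1}^V` is determined by the preimages of the local events of
`Set V`** (π-λ: local events generate the product σ-algebra, `ext_of_isLocalEvent`). [folklore] -/
theorem measure_eq_of_forall_isLocalEvent_preimage_eq (μ₁ μ₂ : Measure (SpinConfig V))
    [IsFiniteMeasure μ₁]
    (h : ∀ A : Set (Set V), IsLocalEvent A →
      μ₁ (spinConfigEquivSet V ⁻¹' A) = μ₂ (spinConfigEquivSet V ⁻¹' A)) : μ₁ = μ₂ := by
  set e := spinConfigEquivSet V with he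
  haveI : IsFiniteMeasure (μ₁.map e) := Measure.isFiniteMeasure_map _ _
  have hmap : μ₁.map e = μ₂.map e := by
    refine ext_of_isLocalEvent fun A hA => ?_
    have hAm : MeasurableSet A := measurableSet_of_isLocalEvent_holds hA
    rw [Measure.map_apply e.measurable hAm, Measure.map_apply e.measurable hAm]
    exact h A hA
  calc μ₁ = (μ₁.map e).map e.symm := (MeasurableEquiv.map_symm_map e).symm
    _ = (μ₂.map e).map e.symm := by rw [hmap]
    _ = μ₂ := MeasurableEquiv.map_symm_map e

/-- **A probability measure on `{±1}^V` is determined by its spin correlations** `∫ σ_B dμ`,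
`B` finite (the spin products span the local observables, Friedli–Velenik 2017, Lemma 3.19).
[cite: FriedliVelenik2017, Lemma 3.19] -/
theorem measure_eq_of_forall_spinCorr_eq [DecidableEq V] (μ₁ μ₂ : Measure (SpinConfig V))
    [IsProbabilityMeasure μ₁] [IsProbabilityMeasure μ₂]
    (h : ∀ B : Finset V, spinCorr μ₁ B = spinCorr μ₂ B) : μ₁ = μ₂ := by
  refine measure_eq_of_forall_isLocalEvent_preimage_eq μ₁ μ₂ fun A hA => ?_
  obtain ⟨J, hJ⟩ := hA
  have hAm : MeasurableSet A := measurableSet_of_isLocalEvent_holds ⟨J, hJ⟩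
  have hpre : MeasurableSet (spinConfigEquivSet V ⁻¹' A) := (spinConfigEquivSet V).measurable hAm
  set χ : SpinConfig V → ℝ := (spinConfigEquivSet V ⁻¹' A).indicator 1 with hχ
  have hχdep : DependsOn χ (↑J : Set V) := dependsOn_indicator_preimage_of_determinedBy hJ
  obtain ⟨c, hc⟩ := exists_sum_spinProduct_of_dependsOn J hχdep
  have hint : ∀ (ρ : Measure (SpinConfig V)) [IsProbabilityMeasure ρ],
      ρ.real (spinConfigEquivSet V ⁻¹' A) =
        ∑ B : Finset ↥J, c B * spinCorr ρ (B.map (Function.Embedding.subtype (· ∈ J))) := by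
    intro ρ _
    rw [← integral_indicator_one hpre, ← hχ, show (fun σ => χ σ) = fun σ => ∑ B : Finset ↥J, c B *
      spinProduct (B.map (Function.Embedding.subtype (· ∈ J))) σ from funext hc,
      integral_finsetSum _ fun B _ => (integrable_spinProduct ρ _).const_mul (c B)]
    refine Finset.sum_congr rfl fun B _ => ?_
    rw [integral_const_mul]
    rfl
  rw [← ofReal_measureReal, ← ofReal_measureReal, hint μ₁, hint μ₂]
  simp_rw [h]

end Determination

/-! ### The DLR equations for limits of free boxes -/

variable {d : ℕ}

/-- `μ^η_{Λ;β,h}(A)` depends on `η` only through its values on the outer boundary of `Λ` and on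
the window of `A` (Friedli–Velenik 2017, §3.6.3, remark after (3.26); here `A` is any event
determined by the spins in `F'`). [cite: FriedliVelenik2017, §3.6.3, eq. (3.26)] -/
theorem dependsOn_isingMeasure_fixed_real (Λ F' : Finset (Site d)) (β h : ℝ)
    {A : Set (SpinConfig (Site d))} (hA : MeasurableSet A)
    (hAdep : ∀ σ τ : SpinConfig (Site d), (∀ x ∈ F', σ x = τ x) → (σ ∈ A ↔ τ ∈ A)) :
    DependsOn (fun η : SpinConfig (Site d) => (isingMeasure (zdGraph d) Λ β h (.fixed η)).real A)
      (↑(outerBoundary (zdGraph d) Λ ∪ F') : Set (Site d)) := by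
  classical
  intro η η' hagree
  have hbd : ∀ y ∈ outerBoundary (zdGraph d) Λ, η y = η' y := fun y hy =>
    hagree y (Finset.mem_coe.2 (Finset.mem_union_left _ hy))
  dsimp only
  rw [measureReal_def, measureReal_def,
    isingMeasure_apply_of_measurableSet (zdGraph d) Λ β h (.fixed η) hA,
    isingMeasure_apply_of_measurableSet (zdGraph d) Λ β h (.fixed η') hA,
    isingPartitionFunction_fixed_congr_outerBoundary (zdGraph d) hbd β h]
  congr 3
  rw [Finset.sum_filter, Finset.sum_filter]
  refine Finset.sum_congr rfl fun τ _ => ?_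
  have hmem : glue Λ τ (.fixed η) ∈ A ↔ glue Λ τ (.fixed η') ∈ A := by
    refine hAdep _ _ fun x hx => ?_
    by_cases hxΛ : x ∈ Λ
    · rw [glue_apply_of_mem _ _ _ hxΛ, glue_apply_of_mem _ _ _ hxΛ]
    · rw [glue_apply_of_notMem _ _ _ hxΛ, glue_apply_of_notMem _ _ _ hxΛ,
        BoundaryCondition.outside_fixed, BoundaryCondition.outside_fixed]
      exact hagree x (Finset.mem_coe.2 (Finset.mem_union_right _ hx))
  rw [isingWeight_fixed_congr_outerBoundary (zdGraph d) hbd β h τ]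
  by_cases hm : glue Λ τ (.fixed η) ∈ A
  · rw [if_pos hm, if_pos (hmem.1 hm)]
  · rw [if_neg hm, if_neg (fun h' => hm (hmem.2 h'))]

/-- The Ising kernel `η ↦ μ^η_{Λ;β,h}` of `ℤ^d` is measurable as a measure-valued map (product
σ-algebra). [cite: Georgii2011, Def. 1.23] -/
theorem measurable_isingMeasure_fixed_zd (Λ : Finset (Site d)) (β h : ℝ) :
    Measurable fun η : SpinConfig (Site d) => isingMeasure (zdGraph d) Λ β h (.fixed η) :=
  Measure.measurable_of_measurable_coe _ fun _s hs =>
    (measurable_isingMeasure_fixed (zdGraph d) Λ β h hs).mono cylinderEvents_le_pi le_rfl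

/-- **Thermodynamic limits of free boxes are Gibbs measures** (Friedli–Velenik 2017, Thm. 6.26
with Exercise 3.16: "any cluster point of finite-volume Gibbs distributions belongs to `𝒢(β,h)`";
free boundary condition). If the free box expectations of every local observable converge to its
`μ`-integral, then `μ` satisfies the DLR equations for the Ising specification of `ℤ^d`: for a
local event `A` the boundary-condition dependence `η ↦ μ^η_Λ(A)` is itself a local observable, so
`∫ μ^η_Λ(A) dμ = lim ⟨μ^·_Λ(A)⟩^∅_{Λ_L} = lim μ^∅_{Λ_L}(A) = μ(A)` by the finite-volume DLR
identity `lintegral_isingMeasure_fixed_free` (valid once `Λ ∪ ∂ᵉˣΛ ⊆ Λ_L`); local events determine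
the measures. No sign condition on `β, h` is needed for this step. [cite: FriedliVelenik2017, Thm. 6.26 and Exercise 3.16] -/
theorem isGibbsMeasure_of_tendsto_isingExpect_free_box {β h : ℝ}
    (μ : Measure (SpinConfig (Site d))) [IsProbabilityMeasure μ]
    (hμ : ∀ (D : Finset (Site d)) (F : SpinConfig (Site d) → ℝ), DependsOn F (↑D : Set (Site d)) →
      Tendsto (fun L : ℕ => isingExpect (zdGraph d) (box d L) β h .free F) atTop (𝓝 (∫ σ, F σ ∂μ))) :
    IsGibbsMeasure (isingSpecification (zdGraph d) β h) μ := by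
  classical
  refine ⟨inferInstance, fun Λ A hA => ?_⟩
  set e := spinConfigEquivSet (Site d) with he
  set κ : SpinConfig (Site d) → Measure (SpinConfig (Site d)) :=
    fun η => isingMeasure (zdGraph d) Λ β h (.fixed η) with hκ
  have hκm : Measurable κ := measurable_isingMeasure_fixed_zd Λ β h
  haveI : ∀ η, IsProbabilityMeasure (κ η) := fun η => by rw [hκ]; infer_instance
  -- the left-hand side as the measure `μ.bind κ`
  set ν₁ : Measure (SpinConfig (Site d)) := μ.bind κ with hν₁
  have hν₁_apply : ∀ {S : Set (SpinConfig (Site d))}, MeasurableSet S →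
      ν₁ S = ∫⁻ η, κ η S ∂μ := fun hS => Measure.bind_apply hS hκm.aemeasurable
  haveI : IsProbabilityMeasure ν₁ := ⟨by
    rw [hν₁_apply MeasurableSet.univ]
    simp⟩
  -- it suffices to compare `ν₁` and `μ` on preimages of local events
  suffices hmain : ν₁ = μ by
    have := hν₁_apply hA
    rw [hmain] at this
    simpa [hκ] using this.symm
  refine measure_eq_of_forall_isLocalEvent_preimage_eq ν₁ μ fun A' hA' => ?_
  obtain ⟨J, hJ⟩ := hA'
  have hA'm : MeasurableSet A' := measurableSet_of_isLocalEvent_holds ⟨J, hJ⟩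
  set S : Set (SpinConfig (Site d)) := e ⁻¹' A' with hS
  have hSm : MeasurableSet S := e.measurable hA'm
  have hSdep : ∀ σ τ : SpinConfig (Site d), (∀ x ∈ J, σ x = τ x) → (σ ∈ S ↔ τ ∈ S) := by
    intro σ τ hst
    exact (determinedBy_iff A' _).1 hJ _ _ (spinConfigEquivSet_inter_eq fun x hx => hst x hx)
  -- the boundary-condition dependence `g η = μ^η_Λ(S)` is a local observable
  set g : SpinConfig (Site d) → ℝ := fun η => (κ η).real S with hg
  have hgdep : DependsOn g (↑(outerBoundary (zdGraph d) Λ ∪ J) : Set (Site d)) :=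
    dependsOn_isingMeasure_fixed_real Λ J β h hSm hSdep
  have hgm : Measurable g := DependsOn.measurable_of_finset _ hgdep
  have hg0 : ∀ η, 0 ≤ g η := fun η => measureReal_nonneg
  have hg1 : ∀ η, g η ≤ 1 := fun η => measureReal_le_one
  have hgi : ∀ (ρ : Measure (SpinConfig (Site d))) [IsFiniteMeasure ρ], Integrable g ρ := fun ρ _ =>
    Integrable.of_bound hgm.aestronglyMeasurable 1 (Eventually.of_forall fun η => by
      rw [Real.norm_eq_abs, abs_of_nonneg (hg0 η)]; exact hg1 η)
  have hκS : ∀ η, κ η S = ENNReal.ofReal (g η) := fun η => (ofReal_measureReal).symm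
  -- `ν₁ S = ofReal (∫ g dμ)`
  have h1 : ν₁ S = ENNReal.ofReal (∫ η, g η ∂μ) := by
    rw [hν₁_apply hSm]
    simp_rw [hκS]
    exact (ofReal_integral_eq_lintegral_ofReal (hgi μ) (Eventually.of_forall hg0)).symm
  -- the indicator of `S` is a local observable too
  set χ : SpinConfig (Site d) → ℝ := S.indicator 1 with hχ
  have hχdep : DependsOn χ (↑J : Set (Site d)) := dependsOn_indicator_preimage_of_determinedBy hJ
  -- in a large free box, `⟨g⟩^∅_{Λ_L} = μ^∅_{Λ_L}(S) = ⟨χ⟩^∅_{Λ_L}` (finite-volume DLR)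
  obtain ⟨L₀, hL₀⟩ := exists_forall_subset_box d (Λ ∪ outerBoundary (zdGraph d) Λ)
  have hbox : ∀ L, L₀ ≤ L →
      isingExpect (zdGraph d) (box d L) β h .free g = isingExpect (zdGraph d) (box d L) β h .free χ := by
    intro L hL
    have hsub : Λ ⊆ box d L := fun x hx => hL₀ L hL (Finset.mem_union_left _ hx)
    have hbd : ∀ x ∈ Λ, ∀ y, (zdGraph d).Adj x y → y ∈ box d L := by
      intro x hx y hxy
      by_cases hy : y ∈ Λ
      · exact hsub hy
      · exact hL₀ L hL (Finset.mem_union_right _ (mem_outerBoundary_iff.2 ⟨hy, x, hx, hxy.symm⟩))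
    have key := lintegral_isingMeasure_fixed_free (zdGraph d) hsub hbd β h hSm
    -- both sides as real numbers
    have hl : ∫⁻ σ, isingMeasure (zdGraph d) Λ β h (.fixed σ) S ∂(isingMeasure (zdGraph d) (box d L) β h .free) =
        ENNReal.ofReal (isingExpect (zdGraph d) (box d L) β h .free g) := by
      change ∫⁻ σ, κ σ S ∂_ = _
      simp_rw [hκS]
      rw [isingExpect]
      exact (ofReal_integral_eq_lintegral_ofReal (hgi _) (Eventually.of_forall hg0)).symm
    have hr : isingMeasure (zdGraph d) (box d L) β h .free S =
        ENNReal.ofReal (isingExpect (zdGraph d) (box d L) β h .free χ) := by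
      rw [isingExpect, hχ, integral_indicator_one hSm, ofReal_measureReal]
    rw [hl, hr] at key
    have hgE : 0 ≤ isingExpect (zdGraph d) (box d L) β h .free g := integral_nonneg hg0
    have hχE : 0 ≤ isingExpect (zdGraph d) (box d L) β h .free χ :=
      integral_nonneg fun σ => Set.indicator_nonneg (fun _ _ => zero_le_one) σ
    exact (ENNReal.ofReal_eq_ofReal_iff hgE hχE).1 key
  -- pass to the limit
  have hlimg := hμ _ g hgdep
  have hlimχ := hμ J χ hχdep
  have heq : ∫ η, g η ∂μ = ∫ σ, χ σ ∂μ := by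
    refine tendsto_nhds_unique hlimg (hlimχ.congr' ?_)
    filter_upwards [eventually_ge_atTop L₀] with L hL
    exact (hbox L hL).symm
  rw [h1, heq, hχ, integral_indicator_one hSm, ofReal_measureReal]

/-! ### Translation invariance -/

/-- Spin products transform under translations: `σ_B(θ_v σ) = σ_{B-v}(σ)`. [folklore] -/
theorem spinProduct_configShift (v : Site d) (B : Finset (Site d)) (σ : SpinConfig (Site d)) :
    spinProduct B (configShift v σ) = spinProduct (B.map (Site.shift (-v)).toEmbedding) σ := by
  rw [spinProduct, spinProduct, Finset.prod_map]
  refine Finset.prod_congr rfl fun x _ => ?_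
  have hx : Site.shift (-v) x = x - v := by simp [Site.shift, sub_eq_add_neg]
  simp only [spinAt, configShift_apply, Equiv.toEmbedding_apply, hx]

/-- **A probability measure with the free correlations is translation invariant** (`β, h ≥ 0`):
its translate has correlations `∫ σ_B ∘ θ_v dμ = ⟨σ_{B-v}⟩^∅ = ⟨σ_B⟩^∅` (`freeCorr_shift`), and
correlations determine the measure (Friedli–Velenik 2017, Exercise 3.16: translation invariance
of `⟨·⟩^∅`). [cite: FriedliVelenik2017, Exercise 3.16] -/
theorem isTranslationInvariantMeasure_of_spinCorr_eq_freeCorr {β h : ℝ} (hβ : 0 ≤ β) (hh : 0 ≤ h)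
    (μ : Measure (SpinConfig (Site d))) [IsProbabilityMeasure μ]
    (hcorr : ∀ A : Finset (Site d), spinCorr μ A = freeCorr d β h A) :
    IsTranslationInvariantMeasure μ := by
  classical
  intro v
  haveI : IsProbabilityMeasure (μ.map (configShift v)) :=
    Measure.isProbabilityMeasure_map (configShift (S := ℤˣ) v).measurable.aemeasurable
  refine measure_eq_of_forall_spinCorr_eq _ _ fun B => ?_
  rw [spinCorr, integral_map (configShift (S := ℤˣ) v).measurable.aemeasurable
    (measurable_spinProduct B).aestronglyMeasurable]
  simp_rw [spinProduct_configShift]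
  change spinCorr μ (B.map (Site.shift (-v)).toEmbedding) = spinCorr μ B
  rw [hcorr, hcorr, freeCorr_shift d hβ hh]

/-! ### The discharge -/

/-- **Discharge of `exists_freeMeasure`** (crit-ising.S05, `GibbsStates.lean`; Friedli–Velenik
2017, Exercise 3.16 (existence and translation invariance of `⟨·⟩^∅` by GKS) and Thm. 6.26
(thermodynamic limits of finite-volume Gibbs measures lie in `𝒢`)): for `β ≥ 0`, `h ≥ 0` there is
a probability measure on `{−1,+1}^{ℤ^d}` satisfying the DLR equations for the Ising
specification, translation invariant, with correlations `⟨σ_A⟩^∅_{β,h} = freeCorr d β h A` — the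
limit measure of `exists_measure_integral_eq_freeExpect` (`FreeStateLimit`), Gibbs by
`isGibbsMeasure_of_tendsto_isingExpect_free_box` and translation invariant by
`isTranslationInvariantMeasure_of_spinCorr_eq_freeCorr`. [cite: FriedliVelenik2017, Exercise 3.16 and Thm. 6.26] -/
theorem exists_freeMeasure_holds (d : ℕ) {β : ℝ} (h : ℝ) : exists_freeMeasure d (β := β) h := by
  intro hβ hh
  obtain ⟨μ, hμP, hμ, hcorr⟩ := exists_measure_integral_eq_freeExpect d hβ hh
  refine ⟨μ, ?_, isTranslationInvariantMeasure_of_spinCorr_eq_freeCorr hβ hh μ hcorr, hcorr⟩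
  rw [mem_isingGibbsMeasures_iff]
  exact isGibbsMeasure_of_tendsto_isingExpect_free_box μ fun D F hF => (hμ D F hF).1

end Literature.Probability.LatticeModels

end
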